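/-
Copyright (c) 2026. All rights reserved.
Released under Apache 2.0 license as described in the file LICENSE.
Authors: abc-iut cell — seat abc-iut-w4-d104 (wave 4, D-0067 cone-interior discharge; node
AbsTopIII:Prop2.6, model of the interface `LocalLinearHolStructure` of `HolomorphicCores.lean`).
-/
import Mathlib.Order.Filter.Germ.Basic
import Mathlib.Analysis.Complex.Basic
import HarnessLib

/-!
# Germs at a point of self-maps of `ℂ` fixing the point ([AbsTopIII] Prop 2.6, carrier)

S. Mochizuki, *Topics in absolute anabelian geometry III*, Prop. 2.6 (a) (kurims manuscript
pp. 57–58, bib key `MochizukiAbsTopIII2015`) considers, for `p ∈ U ⊆ ℂ` open, "the group `𝒜_p` of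
automorphisms of the projective system of connected open neighborhoods of `p` in `U`" that are
compatible with the local additive structures and preserve the orthogonal frames and orientations,
and asserts a natural isomorphism of topological groups `ℂ^× ⥲ 𝒜_p` "induced by the tautological
action of `ℂ^×` on `ℂ ⊇ U`".  The tree's statement file `HolomorphicCores.lean` (seat abc-iut-L4-t14,
p407343) records Prop. 2.6 as the INTERFACE `LocalLinearHolStructure` and says "the germ groups are
not constructed here".  This file constructs their ambient monoid/group.

An automorphism of the projective system of open neighbourhoods of `p` is the same thing as the
GERM at `p` of a homeomorphism between open neighbourhoods of `p` fixing `p`; germs compose.  We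
model this with Mathlib's `Filter.Germ (𝓝 p) ℂ`:

* `LocGerm p` — germs at `𝓝 p` of self-maps `f` of `ℂ` with `Tendsto f (𝓝 p) (𝓝 p)` (equivalently:
  `f` is continuous at `p` and `f p = p`, `LocGerm.apply_pt_of_tendsto`); a MONOID under
  composition of germs (`Filter.Germ.compTendsto'`); its group of units `(LocGerm p)ˣ` is the group
  of germs of local homeomorphisms at `p` fixing `p` = the automorphisms of the projective system.
* `LocGerm.linGerm p L` — the germ of the real-affine map `z ↦ p + L (z - p)` for `L : ℂ →L[ℝ] ℂ`;
  `LocGerm.mulGerm p c` — the germ of `z ↦ p + c (z - p)` ("the tautological action of `ℂ^×`");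
  `LocGerm.mulUnitHom p : ℂˣ →* (LocGerm p)ˣ`, injective (`mulUnitHom_injective`).
* `LocGerm.translateHom p p'` — conjugation by the translation `z ↦ z + (p' - p)`, a monoid
  homomorphism `LocGerm p →* LocGerm p'` (Prop. 2.6 (b): "the local additive structures … determine
  homeomorphisms [by 'translation', i.e., 'addition'] from sufficiently small neighborhoods of `p`
  onto sufficiently small neighborhoods of `p'`; these homeomorphisms thus induce the desired
  isomorphism `𝒜_p ⥲ 𝒜_{p'}`"), with `translate_translate` (chains compose) and `translate_mulGerm`.

The subgroup `𝒜_p ≤ (LocGerm p)ˣ` cut out by the three compatibility conditions, the rigidity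
theorem "`𝒜_p` = the germs `z ↦ p + λ (z - p)`, `λ ∈ ℂˣ`", and the `LocalLinearHolStructure` instance
are in the sequel files `LocalAdditiveGermsLinear.lean`, `HolomorphicCoresLocalLinearProofs.lean`.
Refereed pre-IUT anabelian geometry (elementary topology); nothing here bears on the disputed
[IUTchIII] Cor. 3.12.  Every germ here is a germ of a map on ALL of `ℂ` — for an open `U ∋ p` the
germs at `p` of maps defined near `p` in `U` are the same thing (`𝓝 p` only sees a neighbourhood),
so no generality is lost by not carrying `U`.
-/

noncomputable section

namespace Literature.AnabelianGeometry.AbsoluteAnabelian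

open Filter
open scoped Topology

/-- Composition of germs preserves convergence: if the germ `F` at `l` tends to `lb` and the germ
`G` at `lc` tends to `l`, then the composite germ `F ∘ G` at `lc` tends to `lb`. (Auxiliary.) [cite: MochizukiAbsTopIII2015, Proposition 2.6 (proof) pp.57–58] -/
theorem Germ.tendsto_compTendsto' {α β γ : Type*} {l : Filter α} {lb : Filter β} {lc : Filter γ}
    (F : l.Germ β) (G : lc.Germ α) (hG : G.Tendsto l) (hF : F.Tendsto lb) :
    (F.compTendsto' G hG).Tendsto lb := by
  revert hG hF
  refine G.inductionOn fun g => ?_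
  refine F.inductionOn fun f => ?_
  intro hG hF
  rw [Filter.Germ.coe_compTendsto', Filter.Germ.map_coe, Filter.Germ.coe_tendsto]
  exact (Filter.Germ.coe_tendsto.1 hF).comp (Filter.Germ.coe_tendsto.1 hG)

/-- Two continuous `ℝ`-linear self-maps of `ℂ` that agree on a neighbourhood of `0` are equal
(scale a vector into the neighbourhood). (Auxiliary.) [cite: MochizukiAbsTopIII2015, Proposition 2.6 (proof) pp.57–58] -/
theorem clm_eq_of_eventuallyEq_nhds_zero {L L' : ℂ →L[ℝ] ℂ} (h : ∀ᶠ w in 𝓝 (0 : ℂ), L w = L' w) :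
    L = L' := by
  obtain ⟨ε, hε, hball⟩ := Metric.eventually_nhds_iff.1 h
  refine ContinuousLinearMap.ext fun w => ?_
  by_cases hw : w = 0
  · simp [hw]
  · have hwpos : 0 < ‖w‖ := norm_pos_iff.2 hw
    set t : ℝ := ε / (2 * ‖w‖) with ht
    have htpos : 0 < t := by positivity
    have hmem : dist (t • w) 0 < ε := by
      rw [dist_zero_right, norm_smul, Real.norm_of_nonneg htpos.le, ht]
      calc ε / (2 * ‖w‖) * ‖w‖ = ε / 2 := by field_simp
        _ < ε := by linarith
    have key : t • L w = t • L' w := by simpa only [map_smul] using hball hmem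
    exact smul_right_injective ℂ htpos.ne' key

/-- A **local germ at `p`**: the germ at `𝓝 p` of a self-map of `ℂ` which tends to `p` along `𝓝 p`
(i.e. is continuous at `p` and fixes `p`).  These are the endomorphisms of "the projective system of
[connected] open neighborhoods of `p`"; the automorphisms of that projective system — the ambient
group of [AbsTopIII] Prop. 2.6 (a) — are the units `(LocGerm p)ˣ`.
[cite: MochizukiAbsTopIII2015, Proposition 2.6 (a) p.57] -/
@[ext]
structure LocGerm (p : ℂ) where
  /-- the underlying germ at `𝓝 p` of a self-map of `ℂ` -/
  toGerm : (𝓝 p).Germ ℂ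
  /-- the germ tends to `p` along `𝓝 p` (continuous at `p`, fixes `p`) -/
  tendsto : toGerm.Tendsto (𝓝 p)

namespace LocGerm

variable {p : ℂ}

/-- The local germ at `p` of a self-map `f` of `ℂ` with `f → p` along `𝓝 p`.
[cite: MochizukiAbsTopIII2015, Proposition 2.6 (a) p.57] -/
def ofFun (f : ℂ → ℂ) (hf : Tendsto f (𝓝 p) (𝓝 p)) : LocGerm p :=
  ⟨(f : (𝓝 p).Germ ℂ), hf.germ_tendsto⟩

/-- The underlying germ of `ofFun f`. (Auxiliary.) [cite: MochizukiAbsTopIII2015, Proposition 2.6 (proof) pp.57–58] -/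
@[simp] theorem toGerm_ofFun (f : ℂ → ℂ) (hf : Tendsto f (𝓝 p) (𝓝 p)) :
    (ofFun f hf).toGerm = (f : (𝓝 p).Germ ℂ) := rfl

/-- Two representatives define the same local germ iff they agree near `p`. (Auxiliary.) [cite: MochizukiAbsTopIII2015, Proposition 2.6 (proof) pp.57–58] -/
theorem ofFun_eq_ofFun_iff {f g : ℂ → ℂ} {hf : Tendsto f (𝓝 p) (𝓝 p)}
    {hg : Tendsto g (𝓝 p) (𝓝 p)} : ofFun f hf = ofFun g hg ↔ f =ᶠ[𝓝 p] g := by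
  rw [LocGerm.ext_iff, toGerm_ofFun, toGerm_ofFun, Filter.Germ.coe_eq]

/-- Induction on local germs: it suffices to treat germs of functions. (Auxiliary.) [cite: MochizukiAbsTopIII2015, Proposition 2.6 (proof) pp.57–58] -/
@[elab_as_elim]
theorem inductionOn {P : LocGerm p → Prop} (F : LocGerm p)
    (h : ∀ (f : ℂ → ℂ) (hf : Tendsto f (𝓝 p) (𝓝 p)), P (ofFun f hf)) : P F := by
  obtain ⟨G, hG⟩ := F
  revert hG
  refine G.inductionOn fun f => ?_
  intro hf
  exact h f (Filter.Germ.coe_tendsto.1 hf)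

/-- A self-map tending to `p` along `𝓝 p` fixes `p`. (Auxiliary.) [cite: MochizukiAbsTopIII2015, Proposition 2.6 (proof) pp.57–58] -/
theorem apply_pt_of_tendsto {f : ℂ → ℂ} (hf : Tendsto f (𝓝 p) (𝓝 p)) : f p = p :=
  tendsto_nhds_unique (tendsto_pure_nhds f p) (hf.mono_left (pure_le_nhds p))

/-- A self-map tending to `p` along `𝓝 p` is continuous at `p`. (Auxiliary.) [cite: MochizukiAbsTopIII2015, Proposition 2.6 (proof) pp.57–58] -/
theorem continuousAt_of_tendsto {f : ℂ → ℂ} (hf : Tendsto f (𝓝 p) (𝓝 p)) : ContinuousAt f p := by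
  have h := apply_pt_of_tendsto hf
  unfold ContinuousAt
  rwa [h]

/-- Conversely, a map continuous at `p` with `f p = p` tends to `p` along `𝓝 p`. (Auxiliary.) [cite: MochizukiAbsTopIII2015, Proposition 2.6 (proof) pp.57–58] -/
theorem tendsto_of_continuousAt {f : ℂ → ℂ} (hf : ContinuousAt f p) (hp : f p = p) :
    Tendsto f (𝓝 p) (𝓝 p) := by
  have h : Tendsto f (𝓝 p) (𝓝 (f p)) := hf
  rwa [hp] at h

/-! ### The monoid of local germs under composition -/

/-- The identity germ. [cite: MochizukiAbsTopIII2015, Proposition 2.6 (a) p.57] -/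
instance : One (LocGerm p) := ⟨ofFun id tendsto_id⟩

/-- Composition of local germs `F ∘ G` (well defined since `G → p`).
[cite: MochizukiAbsTopIII2015, Proposition 2.6 (a) p.57] -/
instance : Mul (LocGerm p) :=
  ⟨fun F G => ⟨F.toGerm.compTendsto' G.toGerm G.tendsto,
    Germ.tendsto_compTendsto' _ _ G.tendsto F.tendsto⟩⟩

/-- The identity germ is the germ of `id`. (Auxiliary.) [cite: MochizukiAbsTopIII2015, Proposition 2.6 (proof) pp.57–58] -/
theorem one_def : (1 : LocGerm p) = ofFun id tendsto_id := rfl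

/-- Composition of germs of functions is the germ of the composite. (Auxiliary.) [cite: MochizukiAbsTopIII2015, Proposition 2.6 (proof) pp.57–58] -/
@[simp] theorem ofFun_mul_ofFun (f g : ℂ → ℂ) (hf : Tendsto f (𝓝 p) (𝓝 p))
    (hg : Tendsto g (𝓝 p) (𝓝 p)) :
    ofFun f hf * ofFun g hg = ofFun (f ∘ g) (hf.comp hg) := rfl

/-- Local germs at `p` form a monoid under composition; its units are the germs of local
homeomorphisms at `p` fixing `p` (the automorphisms of the projective system of open neighbourhoods
of `p`). [cite: MochizukiAbsTopIII2015, Proposition 2.6 (a) p.57] -/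
instance : Monoid (LocGerm p) where
  mul_assoc F G H := by
    induction F using LocGerm.inductionOn with
    | h f hf =>
      induction G using LocGerm.inductionOn with
      | h g hg =>
        induction H using LocGerm.inductionOn with
        | h k hk => rfl
  one_mul F := by
    induction F using LocGerm.inductionOn with
    | h f hf => rfl
  mul_one F := by
    induction F using LocGerm.inductionOn with
    | h f hf => rfl

/-! ### Affine and multiplication germs -/

/-- `z ↦ p + L (z - p)` tends to `p` at `p`. (Auxiliary.) [cite: MochizukiAbsTopIII2015, Proposition 2.6 (proof) pp.57–58] -/
theorem tendsto_affine (p : ℂ) (L : ℂ →L[ℝ] ℂ) :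
    Tendsto (fun z : ℂ => p + L (z - p)) (𝓝 p) (𝓝 p) := by
  have hc : Continuous fun z : ℂ => p + L (z - p) := by fun_prop
  simpa using hc.tendsto p

/-- The local germ at `p` of the real-affine map `z ↦ p + L (z - p)`, `L : ℂ →L[ℝ] ℂ`.
[cite: MochizukiAbsTopIII2015, Proposition 2.6 (a) p.57] -/
def linGerm (p : ℂ) (L : ℂ →L[ℝ] ℂ) : LocGerm p :=
  ofFun (fun z => p + L (z - p)) (tendsto_affine p L)

/-- Affine germs compose as their linear parts do. (Auxiliary.) [cite: MochizukiAbsTopIII2015, Proposition 2.6 (proof) pp.57–58] -/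
@[simp] theorem linGerm_mul (L L' : ℂ →L[ℝ] ℂ) :
    linGerm p L * linGerm p L' = linGerm p (L.comp L') := by
  rw [linGerm, linGerm, ofFun_mul_ofFun, linGerm, ofFun_eq_ofFun_iff]
  exact Filter.Eventually.of_forall fun z => by simp

/-- The affine germ of the identity is the identity germ. (Auxiliary.) [cite: MochizukiAbsTopIII2015, Proposition 2.6 (proof) pp.57–58] -/
@[simp] theorem linGerm_id : linGerm p (ContinuousLinearMap.id ℝ ℂ) = 1 := by
  rw [linGerm, one_def, ofFun_eq_ofFun_iff]
  exact Filter.Eventually.of_forall fun z => by simp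

/-- Affine germs are determined by their linear part. (Auxiliary.) [cite: MochizukiAbsTopIII2015, Proposition 2.6 (proof) pp.57–58] -/
theorem linGerm_injective (p : ℂ) : Function.Injective (linGerm p) := by
  intro L L' h
  rw [linGerm, linGerm, ofFun_eq_ofFun_iff] at h
  have ht : Tendsto (fun w : ℂ => p + w) (𝓝 0) (𝓝 p) := by
    have hc : Continuous fun w : ℂ => p + w := by fun_prop
    simpa using hc.tendsto 0
  refine clm_eq_of_eventuallyEq_nhds_zero ((h.comp_tendsto ht).mono fun w hw => ?_)
  simpa using hw

/-- `z ↦ p + c (z - p)` tends to `p` at `p`. (Auxiliary.) [cite: MochizukiAbsTopIII2015, Proposition 2.6 (proof) pp.57–58] -/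
theorem tendsto_mulAffine (p c : ℂ) : Tendsto (fun z : ℂ => p + c * (z - p)) (𝓝 p) (𝓝 p) := by
  have hc : Continuous fun z : ℂ => p + c * (z - p) := by fun_prop
  simpa using hc.tendsto p

/-- The local germ at `p` of `z ↦ p + c (z - p)`: "the tautological action of `ℂ^×` on `ℂ ⊇ U`"
seen at `p`. [cite: MochizukiAbsTopIII2015, Proposition 2.6 (a) p.57] -/
def mulGerm (p : ℂ) (c : ℂ) : LocGerm p :=
  ofFun (fun z => p + c * (z - p)) (tendsto_mulAffine p c)

/-- The multiplication germ of `c` is the affine germ of `c • id`. (Auxiliary.) [cite: MochizukiAbsTopIII2015, Proposition 2.6 (proof) pp.57–58] -/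
theorem mulGerm_eq_linGerm (c : ℂ) :
    mulGerm p c = linGerm p (c • ContinuousLinearMap.id ℝ ℂ) := by
  rw [mulGerm, linGerm, ofFun_eq_ofFun_iff]
  exact Filter.Eventually.of_forall fun z => by simp

/-- Multiplication germs compose multiplicatively (the action of `ℂ^×` is an action).
(Auxiliary.) [cite: MochizukiAbsTopIII2015, Proposition 2.6 (proof) pp.57–58] -/
@[simp] theorem mulGerm_mul (c d : ℂ) : mulGerm p c * mulGerm p d = mulGerm p (c * d) := by
  rw [mulGerm, mulGerm, ofFun_mul_ofFun, mulGerm, ofFun_eq_ofFun_iff]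
  exact Filter.Eventually.of_forall fun z => by simp [mul_assoc]

/-- The multiplication germ of `1` is the identity germ. (Auxiliary.) [cite: MochizukiAbsTopIII2015, Proposition 2.6 (proof) pp.57–58] -/
@[simp] theorem mulGerm_one : mulGerm p 1 = 1 := by
  rw [mulGerm, one_def, ofFun_eq_ofFun_iff]
  exact Filter.Eventually.of_forall fun z => by simp

/-- Near `p` there are points other than `p` at which two germs that agree near `p` agree.
(Auxiliary.) [cite: MochizukiAbsTopIII2015, Proposition 2.6 (proof) pp.57–58] -/
theorem exists_ne_of_eventuallyEq {f g : ℂ → ℂ} (h : f =ᶠ[𝓝 p] g) : ∃ z, z ≠ p ∧ f z = g z := by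
  have h' : ∀ᶠ z in 𝓝[≠] p, f z = g z ∧ z ∈ ({p}ᶜ : Set ℂ) :=
    (h.filter_mono nhdsWithin_le_nhds).and eventually_mem_nhdsWithin
  obtain ⟨z, hz, hzp⟩ := h'.exists
  exact ⟨z, hzp, hz⟩

/-- The tautological action is faithful on germs: `z ↦ p + c (z - p)` and `z ↦ p + d (z - p)` have
the same germ at `p` only if `c = d`. (Auxiliary.) [cite: MochizukiAbsTopIII2015, Proposition 2.6 (proof) pp.57–58] -/
theorem mulGerm_injective (p : ℂ) : Function.Injective (mulGerm p) := by
  intro c d h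
  rw [mulGerm, mulGerm, ofFun_eq_ofFun_iff] at h
  obtain ⟨z, hzp, hz⟩ := exists_ne_of_eventuallyEq h
  have hz' : c * (z - p) = d * (z - p) := by simpa using hz
  exact mul_right_cancel₀ (sub_ne_zero.2 hzp) hz'

/-- The unit of `LocGerm p` given by the multiplication germ of `c ∈ ℂˣ` (inverse: the germ of
`c⁻¹`). [cite: MochizukiAbsTopIII2015, Proposition 2.6 (a) p.57] -/
def mulUnit (p : ℂ) (c : ℂˣ) : (LocGerm p)ˣ where
  val := mulGerm p c
  inv := mulGerm p ↑c⁻¹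
  val_inv := by rw [mulGerm_mul, Units.mul_inv, mulGerm_one]
  inv_val := by rw [mulGerm_mul, Units.inv_mul, mulGerm_one]

/-- The underlying germ of `mulUnit p c`. (Auxiliary.) [cite: MochizukiAbsTopIII2015, Proposition 2.6 (proof) pp.57–58] -/
@[simp] theorem val_mulUnit (c : ℂˣ) : (mulUnit p c : LocGerm p) = mulGerm p c := rfl

/-- The underlying germ of `(mulUnit p c)⁻¹`. (Auxiliary.) [cite: MochizukiAbsTopIII2015, Proposition 2.6 (proof) pp.57–58] -/
@[simp] theorem val_inv_mulUnit (c : ℂˣ) :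
    ((mulUnit p c)⁻¹ : (LocGerm p)ˣ).val = mulGerm p ↑c⁻¹ := rfl

/-- "The tautological action of `ℂ^×`" as a group homomorphism `ℂˣ →* (LocGerm p)ˣ` into the
automorphisms of the projective system of neighbourhoods of `p`.
[cite: MochizukiAbsTopIII2015, Proposition 2.6 (a) p.57] -/
def mulUnitHom (p : ℂ) : ℂˣ →* (LocGerm p)ˣ where
  toFun := mulUnit p
  map_one' := Units.ext (by simp)
  map_mul' c d := Units.ext (by simp)

/-- `mulUnitHom` on elements. (Auxiliary.) [cite: MochizukiAbsTopIII2015, Proposition 2.6 (proof) pp.57–58] -/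
@[simp] theorem mulUnitHom_apply (c : ℂˣ) : mulUnitHom p c = mulUnit p c := rfl

/-- The tautological action `ℂˣ →* (LocGerm p)ˣ` is injective. (Auxiliary.) [cite: MochizukiAbsTopIII2015, Proposition 2.6 (proof) pp.57–58] -/
theorem mulUnitHom_injective (p : ℂ) : Function.Injective (mulUnitHom p) := fun c d h =>
  Units.ext (mulGerm_injective p
    (by simpa using congrArg (fun u : (LocGerm p)ˣ => (u : LocGerm p)) h))

/-! ### Translation: Prop. 2.6 (b) -/

/-- The translation `z ↦ z - (p' - p)` tends to `p` at `p'`. (Auxiliary.) [cite: MochizukiAbsTopIII2015, Proposition 2.6 (proof) pp.57–58] -/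
theorem tendsto_sub_translate (p p' : ℂ) :
    Tendsto (fun z : ℂ => z - (p' - p)) (𝓝 p') (𝓝 p) := by
  have hc : Continuous fun z : ℂ => z - (p' - p) := by fun_prop
  simpa using hc.tendsto p'

/-- The conjugate `z ↦ f (z - (p' - p)) + (p' - p)` of a map tending to `p` at `p` tends to `p'` at
`p'`. (Auxiliary.) [cite: MochizukiAbsTopIII2015, Proposition 2.6 (proof) pp.57–58] -/
theorem tendsto_translate_conj (p p' : ℂ) {f : ℂ → ℂ} (hf : Tendsto f (𝓝 p) (𝓝 p)) :
    Tendsto (fun z : ℂ => f (z - (p' - p)) + (p' - p)) (𝓝 p') (𝓝 p') := by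
  have hc : Continuous fun w : ℂ => w + (p' - p) := by fun_prop
  have h3 : Tendsto (fun w : ℂ => w + (p' - p)) (𝓝 p) (𝓝 p') := by simpa using hc.tendsto p
  exact h3.comp (hf.comp (tendsto_sub_translate p p'))

/-- Conjugation of a local germ at `p` by the translation `z ↦ z + (p' - p)`: a local germ at `p'`
("translation, i.e., addition" transports neighbourhoods of `p` to neighbourhoods of `p'`).
[cite: MochizukiAbsTopIII2015, Proposition 2.6 (b) p.58] -/
def translate (p p' : ℂ) (F : LocGerm p) : LocGerm p' where
  toGerm := (F.toGerm.compTendsto (fun z => z - (p' - p)) (tendsto_sub_translate p p')).map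
    fun w => w + (p' - p)
  tendsto := by
    induction F using LocGerm.inductionOn with
    | h f hf =>
      rw [toGerm_ofFun, Filter.Germ.coe_compTendsto, Filter.Germ.map_coe, Filter.Germ.coe_tendsto]
      exact tendsto_translate_conj p p' hf

/-- Translation conjugation on a germ of a function. (Auxiliary.) [cite: MochizukiAbsTopIII2015, Proposition 2.6 (proof) pp.57–58] -/
theorem translate_ofFun (p p' : ℂ) (f : ℂ → ℂ) (hf : Tendsto f (𝓝 p) (𝓝 p)) :
    translate p p' (ofFun f hf) =
      ofFun (fun z => f (z - (p' - p)) + (p' - p)) (tendsto_translate_conj p p' hf) := rfl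

/-- Translation conjugation preserves the identity germ. (Auxiliary.) [cite: MochizukiAbsTopIII2015, Proposition 2.6 (proof) pp.57–58] -/
@[simp] theorem translate_one (p p' : ℂ) : translate p p' 1 = 1 := by
  rw [one_def, translate_ofFun, one_def, ofFun_eq_ofFun_iff]
  exact Filter.Eventually.of_forall fun z => by simp

/-- Translation conjugation is multiplicative. (Auxiliary.) [cite: MochizukiAbsTopIII2015, Proposition 2.6 (proof) pp.57–58] -/
@[simp] theorem translate_mul (p p' : ℂ) (F G : LocGerm p) :
    translate p p' (F * G) = translate p p' F * translate p p' G := by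
  induction F using LocGerm.inductionOn with
  | h f hf =>
    induction G using LocGerm.inductionOn with
    | h g hg =>
      rw [ofFun_mul_ofFun, translate_ofFun, translate_ofFun, translate_ofFun, ofFun_mul_ofFun,
        ofFun_eq_ofFun_iff]
      exact Filter.Eventually.of_forall fun z => by simp

/-- Translation conjugation as a monoid homomorphism `LocGerm p →* LocGerm p'`.
[cite: MochizukiAbsTopIII2015, Proposition 2.6 (b) p.58] -/
def translateHom (p p' : ℂ) : LocGerm p →* LocGerm p' where
  toFun := translate p p'
  map_one' := translate_one p p'
  map_mul' := translate_mul p p'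

/-- `translateHom` on elements. (Auxiliary.) [cite: MochizukiAbsTopIII2015, Proposition 2.6 (proof) pp.57–58] -/
@[simp] theorem translateHom_apply (p p' : ℂ) (F : LocGerm p) :
    translateHom p p' F = translate p p' F := rfl

/-- Translating from `p` to `p` is the identity. (Auxiliary.) [cite: MochizukiAbsTopIII2015, Proposition 2.6 (proof) pp.57–58] -/
@[simp] theorem translate_self (p : ℂ) (F : LocGerm p) : translate p p F = F := by
  induction F using LocGerm.inductionOn with
  | h f hf =>
    rw [translate_ofFun, ofFun_eq_ofFun_iff]
    exact Filter.Eventually.of_forall fun z => by simp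

/-- Chains of translations compose: "independent of the choice of a chain".
[cite: MochizukiAbsTopIII2015, Proposition 2.6 (b) p.58] -/
@[simp] theorem translate_translate (p p' p'' : ℂ) (F : LocGerm p) :
    translate p' p'' (translate p p' F) = translate p p'' F := by
  induction F using LocGerm.inductionOn with
  | h f hf =>
    rw [translate_ofFun, translate_ofFun, translate_ofFun, ofFun_eq_ofFun_iff]
    refine Filter.Eventually.of_forall fun z => ?_
    ring_nf

/-- Translation conjugation carries the affine germ of `L` at `p` to the affine germ of `L` at `p'`.
(Auxiliary.) [cite: MochizukiAbsTopIII2015, Proposition 2.6 (proof) pp.57–58] -/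
@[simp] theorem translate_linGerm (p p' : ℂ) (L : ℂ →L[ℝ] ℂ) :
    translate p p' (linGerm p L) = linGerm p' L := by
  rw [linGerm, translate_ofFun, linGerm, ofFun_eq_ofFun_iff]
  refine Filter.Eventually.of_forall fun z => ?_
  simp only
  rw [show z - (p' - p) - p = z - p' by ring, show p + L (z - p') + (p' - p) = p' + L (z - p') by ring]

/-- Translation conjugation carries the multiplication germ of `c` at `p` to the one at `p'`.
(Auxiliary.) [cite: MochizukiAbsTopIII2015, Proposition 2.6 (proof) pp.57–58] -/
@[simp] theorem translate_mulGerm (p p' : ℂ) (c : ℂ) :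
    translate p p' (mulGerm p c) = mulGerm p' c := by
  rw [mulGerm, translate_ofFun, mulGerm, ofFun_eq_ofFun_iff]
  exact Filter.Eventually.of_forall fun z => by ring

end LocGerm

end Literature.AnabelianGeometry.AbsoluteAnabelian

end
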